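import Literature.NumberTheory.GaloisRepresentations.CentralInvolutionQuotientProofs
import Literature.NumberTheory.GaloisRepresentations.SqrtUpperRamificationProofs
import HarnessLib

/-!
# The quotient by a central involution, II: wildness from the ramification index, `#G₁ = 2#Q₁`,
# and the layers of `K̄` (Serre, *Local Fields*, Ch. IV §§1–3)

`Proofs` file (theorems only, no definitions, no named facts) in topic
`NumberTheory/GaloisRepresentations`, sequel of `CentralInvolutionBreakProofs` and
`CentralInvolutionQuotientProofs`, landed by the seat of bsd.S15
(`Literature.NumberTheory.EllipticCurves.conductorNorm_eq_artinConductorNat_of_isElliptic`) for the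
Galois side of Ogg's formula above `2` (Silverman *ATAEC* Thm. IV.11.1, `p = 2`, PDF p. 366).
It supplies the bookkeeping that turns the break formula `Sw(E[3]) = 2φ_{E/K}(b)`
(`ThreeTorsionCentralInvolutionSwanProofs`) into numbers:

* `lowerIndex_eq_of_ord_smul_sub_eq` — the solved form `i_G(σ) = v(σx - x) - v(x) + 1` of
  `ord_smul_sub_eq_of_lowerIndex_eq` (index of a wild element read on an element of order prime
  to `p`); `card_ramificationSubgroup_one_eq_pow_factorization` — `#G₁ = p^{v_p(#G₀)}`;
* `ramificationSubgroup_one_ne_bot_of_ringChar_dvd_card` — **wildness from the ramification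
  index**: if the residue characteristic divides `#G₀ = e`, then `G₁ ≠ 1` (`[G₀ : G₁]` is prime
  to `p`, Serre IV §2 Cor. 1); at `p = 2`: an even ramification index forces wild ramification;
* `card_ramificationSubgroup_one_eq_two_mul_quotient` — **`#G₁ = 2 · #Q₁`** for the quotient
  `Q = Gal(E/K)` of `G = Gal(L/K)` by a kernel `{1, ι}` with `ι ∈ G₁` (Herbrand's theorem in the
  lower numbering, `π(G₁) = Q₁`, Serre IV §3 Lemma 5, with `φ_{L/E}(1) = 1`); companion of
  `card_inertia_eq_two_mul_card_inertia_quotient` (`#G₀ = 2 · #Q₀`);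
* **layers of `K̄`** over a number field (`E ≤ L` finite normal intermediate fields of `K̄/K`,
  `𝔓 ∣ v` a prime of `\bar ℤ_K`, kernel condition `σ|_E = 1 ↔ σ|_L ∈ {1, ι}` on `Γ_K`):
  `herbrandPhi_layer_eq`, `card_ramificationSubgroup_layer_eq` (transport of `φ_{E/K}` and `#Q_i`
  from the copy of `E` inside `L`, `RamificationFiltrationTowerProofs`),
  `herbrandPhi_eq_herbrandPhi_layer_of_lowerIndex_eq` (**`φ_{L/K}(b) = φ_{E/K}(b)`**),
  `card_ramificationSubgroup_zero_eq_two_mul_layer` (**`#G₀(𝔓 ∩ L) = 2 · #Q₀(𝔓 ∩ E)`**),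
  `card_ramificationSubgroup_one_eq_two_mul_layer` (**`#G₁(𝔓 ∩ L) = 2 · #Q₁(𝔓 ∩ E)`**) and
  `absRestrictNormalHom_mem_ramificationSubgroup_one_iff_layer` (**`σ|_L ∈ G₁ ↔ σ|_E ∈ Q₁`**).

So, for the `3`-division field `L = K(E[3]) ⊇ E = K(x(E[3]))` of an elliptic curve at `𝔓 ∣ 2`:
`e = #G₀` even gives the central involution `ι ∈ G₁`; `#Q₀ = e/2`, `#Q₁ = #G₁/2 ∈ {1, 2, 4}`;
and `#Q₀ · φ_{E/K}(b) = b + Σ_{τ ∈ Q₁ ∖ 1} (i_Q(τ) - 1)`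
(`card_mul_herbrandPhi_eq_of_lowerIndex_eq_of_wild`).

## References

* J.-P. Serre, *Local Fields*, GTM 67 (1979), Ch. IV §1 Prop. 2–3, §2 Cor. 1 and 3 of Prop. 7,
  §3 Lemmas 3–5 and Prop. 14–15 (pp. 61–76); Ch. I §7 Prop. 22. [SerreLocalFields1979]
* J. H. Silverman, *Advanced Topics in the Arithmetic of Elliptic Curves*, GTM 151 (1994),
  Thm. IV.11.1, case `p = 2` (PDF p. 366). [SilvermanATAEC1994]

## Design

No definitions.  The generic statements keep the setting of `CentralInvolutionQuotientProofs`;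
the layer statements are over a number field `K` with `𝔓 ∈ v.primesAbove`, the instances of the
generic theorems (`IsMaximal`, residue separability; the `𝓞 K`-algebra structure on `L` hidden in
`integralClosure` is `IntermediateField.algebra'`) being passed explicitly.
`noncomputable section`; namespace `Literature.NumberTheory.GaloisRepresentations`.  Axioms:
`propext`, `Classical.choice`, `Quot.sound`.
-/

noncomputable section

open scoped Pointwise NumberField
open Field IsDedekindDomain

universe u

namespace Literature.NumberTheory.GaloisRepresentations

/-! ### Wildness from the ramification index -/

section Wild

variable {S : Type*} [CommRing S] [IsDedekindDomain S] {G : Type*} [Group G]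
  [MulSemiringAction G S] {Q : Ideal S} [Q.IsMaximal]

/-- **If the residue characteristic divides the ramification index then the ramification is
wild.**  Let `Q ≠ 0` be a maximal ideal with finite residue field of the Dedekind domain `S`
acted on by `G`.  If `p = char(S/Q)` divides `#G₀`, then `G₁ ≠ 1`: otherwise
`#G₀ = [G₀ : G₁]` would be prime to `p` (Serre, Ch. IV §2, Cor. 1 of Prop. 7:
`G₀/G₁ ↪ κ(Q)ˣ`).  At `p = 2`: an even ramification index forces `G₁ ≠ 1`.
[cite: SerreLocalFields1979, Ch. IV §2 Cor. 1 of Prop. 7] -/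
theorem ramificationSubgroup_one_ne_bot_of_ringChar_dvd_card [Finite (S ⧸ Q)] (hQ : Q ≠ ⊥)
    (hdvd : ringChar (S ⧸ Q) ∣ Nat.card (Q.ramificationSubgroup G 0)) :
    Q.ramificationSubgroup G 1 ≠ ⊥ := by
  intro h1
  have hcop := relIndex_ramificationSubgroup_one_coprime_ringChar (G := G) hQ
  rw [h1, Subgroup.relIndex_bot_left] at hcop
  have hp : (ringChar (S ⧸ Q)).Prime := CharP.char_is_prime (S ⧸ Q) _
  exact hp.ne_one (hcop.symm.eq_one_of_dvd hdvd)

/-- **`i_G(σ) = v_P(σx - x) - v_P(x) + 1`**, solved form of `ord_smul_sub_eq_of_lowerIndex_eq`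
(`CentralInvolutionBreakProofs`): for `σ ∈ G₁` and `x` with `v_P(x) = n` a unit mod `P` and
`v_P(σx - x) = m`, one has `n ≤ m` and `i_G(σ) = (m - n) + 1`.  (`i_G(σ)` is finite: were
`σ ∈ G_i` for all `i`, then `σx - x ∈ ⋂ Pⁱ`, contradicting `v_P(σx - x) = m < ∞`.)  With
`x = c x₁ + s` (`c, s` in the base) this reads the index of `σ` on a root difference
`σx - x = c(σx₁ - x₁)`.  [cite: SerreLocalFields1979, Ch. IV §1 (i_G) and §2 Prop. 5] -/
theorem lowerIndex_eq_of_ord_smul_sub_eq [Finite (S ⧸ Q)] (hQ : Q ≠ ⊥) {σ : G}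
    (hσ : σ ∈ Q.ramificationSubgroup G 1) {x : S} {m n : ℕ} (hm : ord Q (σ • x - x) = m)
    (hx : ord Q x = n) (hn : (n : S) ∉ Q) :
    n ≤ m ∧ lowerIndex Q G σ = ((m - n : ℕ) : ℕ∞) + 1 := by
  have hfin : lowerIndex Q G σ ≠ ⊤ := by
    intro htop
    have hall := (lowerIndex_eq_top_iff Q).mp htop
    have hle : ∀ i : ℕ, (i : ℕ∞) ≤ ord Q (σ • x - x) := fun i =>
      (mem_pow_iff_le_ord Q).mp (Ideal.pow_le_pow_right (Nat.le_succ i) ((hall i).2 x))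
    have := hle (m + 1)
    rw [hm] at this
    exact absurd (Nat.cast_le.mp this) (by omega)
  obtain ⟨k, hk⟩ := ENat.ne_top_iff_exists.mp hfin
  have hk2 : 2 ≤ k := by
    have h' := add_one_le_lowerIndex Q hσ
    rw [← hk] at h'
    have : ((1 + 1 : ℕ) : ℕ∞) ≤ (k : ℕ∞) := by push_cast at h' ⊢; exact h'
    have := Nat.cast_le.mp this
    omega
  obtain ⟨j, rfl⟩ : ∃ j, k = j + 1 := ⟨k - 1, by omega⟩
  have hj : lowerIndex Q G σ = j + 1 := by rw [← hk]; push_cast; rfl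
  have h := ord_smul_sub_eq_of_lowerIndex_eq hQ hσ hj hx hn
  rw [hm] at h
  have hmj : m = j + n := Nat.cast_injective (R := ℕ∞) h
  refine ⟨by omega, ?_⟩
  rw [hj, show m - n = j by omega]

omit [IsDedekindDomain S] [Q.IsMaximal] in
/-- **`#G₁` is the `p`-part of `#G₀`**: if `G₁` is a `p`-group (Serre IV §2 Cor. 3) of index
prime to `p` in `G₀` (Cor. 1, `relIndex_ramificationSubgroup_one_coprime_ringChar`), then
`#G₁ = p ^ v_p(#G₀)`.  [cite: SerreLocalFields1979, Ch. IV §2 Cor. 1 and Cor. 3 of Prop. 7] -/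
theorem card_ramificationSubgroup_one_eq_pow_factorization [Finite G] {p : ℕ} [Fact p.Prime]
    (hG1 : IsPGroup p (Q.ramificationSubgroup G 1))
    (hcop : ((Q.ramificationSubgroup G 1).relIndex (Q.ramificationSubgroup G 0)).Coprime p) :
    Nat.card (Q.ramificationSubgroup G 1) = p ^ (Nat.card (Q.ramificationSubgroup G 0)).factorization p := by
  have hp : p.Prime := Fact.out
  obtain ⟨k, hk⟩ := hG1.exists_card_eq
  have hle : Q.ramificationSubgroup G 1 ≤ Q.ramificationSubgroup G 0 :=
    Q.ramificationSubgroup_antitone G (Nat.zero_le 1)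
  -- `#G₁ · [G₀ : G₁] = #G₀`
  have hmul : Nat.card (Q.ramificationSubgroup G 1) *
      (Q.ramificationSubgroup G 1).relIndex (Q.ramificationSubgroup G 0) =
      Nat.card (Q.ramificationSubgroup G 0) := by
    rw [Subgroup.relIndex, ← Nat.card_congr (Subgroup.subgroupOfEquivOfLe hle).toEquiv]
    exact Subgroup.card_mul_index _
  have hidx0 : (Q.ramificationSubgroup G 1).relIndex (Q.ramificationSubgroup G 0) ≠ 0 := by
    intro h0
    rw [h0, mul_zero] at hmul
    exact Nat.card_pos.ne' hmul.symm
  rw [← hmul, hk, Nat.factorization_mul (pow_ne_zero k hp.ne_zero) hidx0, hp.factorization_pow,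
    Finsupp.add_apply, Finsupp.single_eq_same,
    Nat.factorization_eq_zero_of_not_dvd fun h => hp.ne_one (hcop.symm.eq_one_of_dvd h), add_zero]

end Wild

/-! ### `#G₁ = 2 · #Q₁` through the quotient by `{1, ι}`, `ι ∈ G₁` -/

section Quotient

variable (R : Type*) {K L : Type*} [CommRing R] [IsDedekindDomain R] [Field K] [Field L]
  [Algebra R K] [IsFractionRing R K] [Algebra R L] [Algebra K L] [IsScalarTower R K L]
  [FiniteDimensional K L] [IsGalois K L] (E : IntermediateField K L) [Normal K E]
  (𝔓 : Ideal (integralClosure R L)) [𝔓.IsMaximal]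
  [Algebra.IsSeparable (R ⧸ 𝔓.under R) (integralClosure R L ⧸ 𝔓)]

set_option synthInstance.maxHeartbeats 400000 in
/-- **`π(G₁) = Q₁`** for the quotient `π : Gal(L/K) → Gal(E/K) = Q` by a kernel `{1, ι}` with
`ι ∈ G₁`: Herbrand's theorem in the lower numbering (Serre's Lemma 5, `π(G_u) = Q_{φ_{L/E}(u)}`)
at `u = 1`, where `φ_{L/E}(1) = 1` because the filtration of `Gal(L/E) = {1, ι}` is constant on
`[0, 1]`.  [cite: SerreLocalFields1979, Ch. IV §3 Lemma 5 (p. 75)] -/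
theorem map_ramificationSubgroup_one_eq_of_mem {ι : L ≃ₐ[K] L}
    (hker : ∀ σ : L ≃ₐ[K] L, AlgEquiv.restrictNormalHom E σ = 1 ↔ σ = 1 ∨ σ = ι)
    (h1 : ι ∈ 𝔓.ramificationSubgroup (L ≃ₐ[K] L) 1) :
    (𝔓.ramificationSubgroup (L ≃ₐ[K] L) 1).map
        (AlgEquiv.restrictNormalHom E : (L ≃ₐ[K] L) →* (E ≃ₐ[K] E)) =
      (𝔓.comap (E.integralClosureInclusion R)).ramificationSubgroup (E ≃ₐ[K] E) 1 := by
  haveI : IsFractionRing (integralClosure R L) L :=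
    integralClosure.isFractionRing_of_finite_extension K L
  haveI : FaithfulSMul (L ≃ₐ[K] L) (integralClosure R L) :=
    (IsGaloisGroup.of_isFractionRing (L ≃ₐ[K] L) R (integralClosure R L) K L).faithful
  haveI : IsNoetherianRing (integralClosure R L) := integralClosure.isNoetherianRing (K := K) L
  set π : (L ≃ₐ[K] L) →* (E ≃ₐ[K] E) := AlgEquiv.restrictNormalHom E with hπ
  obtain ⟨N, hN⟩ := Ideal.ramificationSubgroup_eventually_eq_bot_holds 𝔓 (L ≃ₐ[K] L)
    (Ideal.IsMaximal.ne_top inferInstance)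
  have hI : (𝔓.ramificationSubgroup (L ≃ₐ[K] L) 0).map π =
      (𝔓.comap (E.integralClosureInclusion R)).ramificationSubgroup (E ≃ₐ[K] E) 0 := by
    rw [Ideal.ramificationSubgroup_zero, Ideal.ramificationSubgroup_zero]
    exact map_inertia_restrictNormalHom R E 𝔓
  have h3 : IndexFormula 𝔓 (𝔓.comap (E.integralClosureInclusion R)) π := IndexFormula_holds R E 𝔓
  have hmap := map_ramificationSubgroup_eq_of_indexFormula 𝔓 _ π hI (hN N le_rfl) h3 (1 : ℝ)
  have hφ : herbrandPhi 𝔓 π.ker (1 : ℝ) = 1 := by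
    have := herbrandPhi_eq_self_of_le 𝔓 π.ker (b := 1)
      (fun i hi => ramificationSubgroup_ker_eq_of_le R E 𝔓 hker h1 hi) zero_le_one
      (by rw [Nat.cast_one])
    exact this
  rw [hφ, Nat.ceil_one] at hmap
  exact hmap

set_option synthInstance.maxHeartbeats 400000 in
/-- **`#G₁ = 2 · #Q₁`**: if the kernel of `Gal(L/K) → Gal(E/K) = Q` is `{1, ι}` with
`ι ≠ 1` in `G₁`, then `#G₁(𝔓) = 2 · #Q₁(𝔓 ∩ E)` (`π(G₁) = Q₁` and `G₁ ∩ ker π = {1, ι}`).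
[cite: SerreLocalFields1979, Ch. IV §3 Lemma 5 (p. 75) and §1 Prop. 2] -/
theorem card_ramificationSubgroup_one_eq_two_mul_quotient {ι : L ≃ₐ[K] L} (hι : ι ≠ 1)
    (hker : ∀ σ : L ≃ₐ[K] L, AlgEquiv.restrictNormalHom E σ = 1 ↔ σ = 1 ∨ σ = ι)
    (h1 : ι ∈ 𝔓.ramificationSubgroup (L ≃ₐ[K] L) 1) :
    Nat.card (𝔓.ramificationSubgroup (L ≃ₐ[K] L) 1) =
      2 * Nat.card ((𝔓.comap (E.integralClosureInclusion R)).ramificationSubgroup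
        (E ≃ₐ[K] E) 1) := by
  classical
  set π : (L ≃ₐ[K] L) →* (E ≃ₐ[K] E) := AlgEquiv.restrictNormalHom E with hπ
  have hmap := map_ramificationSubgroup_one_eq_of_mem R E 𝔓 hker h1
  have h := card_map_mul_card_ramificationSubgroup_ker 𝔓 π 1
  rw [hmap] at h
  -- `#(ker π)_1 = #(ker π)_0 = 2`
  have hker1 : Nat.card (𝔓.ramificationSubgroup π.ker 1) = 2 := by
    rw [ramificationSubgroup_ker_eq_of_le R E 𝔓 hker h1 le_rfl]
    have h0 : ι ∈ 𝔓.ramificationSubgroup (L ≃ₐ[K] L) 0 :=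
      𝔓.ramificationSubgroup_antitone _ (Nat.zero_le 1) h1
    have hG0 := card_inertia_eq_two_mul_card_inertia_quotient R E 𝔓 hι hker h0
    have hI : (𝔓.ramificationSubgroup (L ≃ₐ[K] L) 0).map π =
        (𝔓.comap (E.integralClosureInclusion R)).ramificationSubgroup (E ≃ₐ[K] E) 0 := by
      rw [Ideal.ramificationSubgroup_zero, Ideal.ramificationSubgroup_zero]
      exact map_inertia_restrictNormalHom R E 𝔓
    have h' := card_map_mul_card_ramificationSubgroup_ker 𝔓 π 0
    rw [hI, hG0] at h'
    have hpos : 0 < Nat.card ((𝔓.comap (E.integralClosureInclusion R)).ramificationSubgroup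
        (E ≃ₐ[K] E) 0) := Nat.card_pos
    -- `#Q₀ · #(ker)_0 = 2 #Q₀`
    exact Nat.eq_of_mul_eq_mul_left hpos (h'.trans (mul_comm _ _))
  rw [hker1] at h
  omega

end Quotient

/-! ### Layers of `K̄` over a number field -/

section Layer

variable {K : Type u} [Field K] [NumberField K]
  {v : HeightOneSpectrum (𝓞 K)} {𝔓 : Ideal (absIntegers (𝓞 K) K)}
  (L E : IntermediateField K (AlgebraicClosure K)) [FiniteDimensional K L] [Normal K L]
  [Normal K E]

omit [NumberField K] [FiniteDimensional K L] [Normal K L] [Normal K E] in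
/-- Transport of `φ_{E/K}` at `𝔓 ∩ E` from the copy `restrict hle` of `E` inside `L` (the filtration
only depends on the orders `#Q_i`, which are transported along `E ≃ restrict hle`).
[cite: SerreLocalFields1979, Ch. IV §3 (definition of φ)] -/
theorem herbrandPhi_layer_eq (hle : E ≤ L) :
    herbrandPhi (𝔓.comap (E.integralClosureToAbsIntegers (𝓞 K))) (E ≃ₐ[K] E) =
      herbrandPhi ((𝔓.comap (L.integralClosureToAbsIntegers (𝓞 K))).comap
        ((IntermediateField.restrict hle).integralClosureInclusion (𝓞 K)))
        (IntermediateField.restrict hle ≃ₐ[K] IntermediateField.restrict hle) := by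
  rw [← comap_restrict_mapIntegralClosure (𝓞 K) hle 𝔓]
  exact herbrandPhi_comap_ringEquiv
    (((IntermediateField.restrict_algEquiv hle).restrictScalars (𝓞 K)).mapIntegralClosure.toRingEquiv)
    ((IntermediateField.restrict_algEquiv hle).autCongr).toMonoidHom
    (restrict_mapIntegralClosure_smul (𝓞 K) hle)
    ((IntermediateField.restrict_algEquiv hle).autCongr).bijective _

omit [NumberField K] [FiniteDimensional K L] [Normal K L] [Normal K E] in
/-- Transport of the orders `#Q_i` at `𝔓 ∩ E` from the copy `restrict hle` of `E` inside `L`.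
[cite: SerreLocalFields1979, Ch. IV §1] -/
theorem card_ramificationSubgroup_layer_eq (hle : E ≤ L) (i : ℕ) :
    Nat.card ((𝔓.comap (E.integralClosureToAbsIntegers (𝓞 K))).ramificationSubgroup
        (E ≃ₐ[K] E) i) =
      Nat.card (((𝔓.comap (L.integralClosureToAbsIntegers (𝓞 K))).comap
        ((IntermediateField.restrict hle).integralClosureInclusion (𝓞 K))).ramificationSubgroup
        (IntermediateField.restrict hle ≃ₐ[K] IntermediateField.restrict hle) i) := by
  rw [← comap_restrict_mapIntegralClosure (𝓞 K) hle 𝔓]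
  exact card_ramificationSubgroup_comap_ringEquiv
    (((IntermediateField.restrict_algEquiv hle).restrictScalars (𝓞 K)).mapIntegralClosure.toRingEquiv)
    ((IntermediateField.restrict_algEquiv hle).autCongr).toMonoidHom
    (restrict_mapIntegralClosure_smul (𝓞 K) hle)
    ((IntermediateField.restrict_algEquiv hle).autCongr).bijective _ i

omit [NumberField K] [FiniteDimensional K L] in
/-- The kernel condition `σ|_E = 1 ↔ σ|_L ∈ {1, ι}` on `Γ_K` gives the kernel `{1, ι}` of
`Gal(L/K) → Gal(restrict hle/K)`. [folklore] -/
theorem restrictNormalHom_restrict_eq_one_iff (hle : E ≤ L)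
    [Normal K (IntermediateField.restrict hle)]
    {ι : L ≃ₐ[K] L}
    (hkerE : ∀ σ : absoluteGaloisGroup K, absRestrictNormalHom E σ = 1 ↔
      absRestrictNormalHom L σ = 1 ∨ absRestrictNormalHom L σ = ι)
    (g : L ≃ₐ[K] L) :
    AlgEquiv.restrictNormalHom (IntermediateField.restrict hle) g = 1 ↔ g = 1 ∨ g = ι := by
  obtain ⟨σ, rfl⟩ : ∃ σ : absoluteGaloisGroup K, absRestrictNormalHom L σ = g := by
    obtain ⟨σ, hσ⟩ := AlgEquiv.restrictNormalHom_surjective (F := K) (K₁ := L)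
      (E := AlgebraicClosure K) g
    exact ⟨(absoluteGaloisGroup.toAlgEquiv K).symm σ, hσ⟩
  rw [restrictNormalHom_restrict_absRestrictNormalHom hle σ, ← hkerE σ, MulEquiv.map_eq_one_iff]

variable (h𝔓 : 𝔓 ∈ v.primesAbove)
include h𝔓

/-- **`φ_{L/K}(b) = φ_{E/K}(b)` for layers `E ≤ L` of `K̄`** over a number field: `L/K`, `E/K`
finite normal, `𝔓 ∣ v` a prime of `\bar ℤ_K`, `ι ∈ Gal(L/K)` with `σ|_E = 1 ↔ σ|_L ∈ {1, ι}`
and `i_{Gal(L/K)}(ι) = b + 1` at `𝔓 ∩ L`.  (`herbrandPhi_eq_herbrandPhi_quotient_of_lowerIndex_eq`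
for the copy of `E` inside `L`, transported by `herbrandPhi_layer_eq`.)
[cite: SerreLocalFields1979, Ch. IV §3 Prop. 15 (pp. 75–76)] -/
theorem herbrandPhi_eq_herbrandPhi_layer_of_lowerIndex_eq (hle : E ≤ L) {ι : L ≃ₐ[K] L}
    (hkerE : ∀ σ : absoluteGaloisGroup K, absRestrictNormalHom E σ = 1 ↔
      absRestrictNormalHom L σ = 1 ∨ absRestrictNormalHom L σ = ι)
    {b : ℕ} (hb : lowerIndex (𝔓.comap (L.integralClosureToAbsIntegers (𝓞 K))) (L ≃ₐ[K] L) ι =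
      b + 1) :
    herbrandPhi (𝔓.comap (L.integralClosureToAbsIntegers (𝓞 K))) (L ≃ₐ[K] L) b =
      herbrandPhi (𝔓.comap (E.integralClosureToAbsIntegers (𝓞 K))) (E ≃ₐ[K] E) b := by
  haveI : 𝔓.IsPrime := h𝔓.1
  haveI : 𝔓.IsMaximal := HeightOneSpectrum.isMaximal_of_mem_primesAbove h𝔓
  haveI : IsGalois K L := {}
  haveI : Normal K (IntermediateField.restrict hle) :=
    Normal.of_algEquiv (IntermediateField.restrict_algEquiv hle)
  set 𝔓L := 𝔓.comap (L.integralClosureToAbsIntegers (𝓞 K)) with h𝔓L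
  haveI hmaxL : 𝔓L.IsMaximal := isMaximal_comap_integralClosureToAbsIntegers (𝓞 K) 𝔓 L
  haveI : Finite ((𝓞 K) ⧸ 𝔓.under (𝓞 K)) := by
    rw [← h𝔓.2.over]
    exact Ideal.finiteQuotientOfFreeOfNeBot v.asIdeal v.ne_bot
  haveI hsepL : Algebra.IsSeparable ((𝓞 K) ⧸ 𝔓L.under (𝓞 K)) (integralClosure (𝓞 K) L ⧸ 𝔓L) :=
    isSeparable_residue_comap (𝓞 K) 𝔓 L
  have hker := restrictNormalHom_restrict_eq_one_iff L E hle hkerE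
  have key : herbrandPhi 𝔓L (L ≃ₐ[K] L) b =
      herbrandPhi (𝔓L.comap ((IntermediateField.restrict hle).integralClosureInclusion (𝓞 K)))
        (IntermediateField.restrict hle ≃ₐ[K] IntermediateField.restrict hle) b :=
    @herbrandPhi_eq_herbrandPhi_quotient_of_lowerIndex_eq (𝓞 K) K L _ _ _ _ _ _ _ _ _ _ _
      (IntermediateField.restrict hle) _ 𝔓L hmaxL hsepL ι hker b hb
  rw [key, herbrandPhi_layer_eq L E hle]

/-- **`#G₀(𝔓 ∩ L) = 2 · #Q₀(𝔓 ∩ E)` for layers `E ≤ L` of `K̄`** with kernel `{1, ι}`,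
`ι ≠ 1` in the inertia group of `𝔓 ∩ L` (`card_inertia_eq_two_mul_card_inertia_quotient`
transported).  [cite: SerreLocalFields1979, Ch. I §7 Prop. 22 and Ch. IV §1 Prop. 2] -/
theorem card_ramificationSubgroup_zero_eq_two_mul_layer (hle : E ≤ L) {ι : L ≃ₐ[K] L} (hι : ι ≠ 1)
    (hkerE : ∀ σ : absoluteGaloisGroup K, absRestrictNormalHom E σ = 1 ↔
      absRestrictNormalHom L σ = 1 ∨ absRestrictNormalHom L σ = ι)
    (h0 : ι ∈ (𝔓.comap (L.integralClosureToAbsIntegers (𝓞 K))).ramificationSubgroup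
      (L ≃ₐ[K] L) 0) :
    Nat.card ((𝔓.comap (L.integralClosureToAbsIntegers (𝓞 K))).ramificationSubgroup
        (L ≃ₐ[K] L) 0) =
      2 * Nat.card ((𝔓.comap (E.integralClosureToAbsIntegers (𝓞 K))).ramificationSubgroup
        (E ≃ₐ[K] E) 0) := by
  haveI : 𝔓.IsPrime := h𝔓.1
  haveI : IsGalois K L := {}
  haveI : Normal K (IntermediateField.restrict hle) :=
    Normal.of_algEquiv (IntermediateField.restrict_algEquiv hle)
  haveI : (𝔓.comap (L.integralClosureToAbsIntegers (𝓞 K))).IsPrime := Ideal.IsPrime.comap _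
  have hker := restrictNormalHom_restrict_eq_one_iff L E hle hkerE
  rw [card_ramificationSubgroup_layer_eq L E hle 0]
  exact card_inertia_eq_two_mul_card_inertia_quotient (𝓞 K) (IntermediateField.restrict hle)
    (𝔓.comap (L.integralClosureToAbsIntegers (𝓞 K))) hι hker h0

/-- **`#G₁(𝔓 ∩ L) = 2 · #Q₁(𝔓 ∩ E)` for layers `E ≤ L` of `K̄`** with kernel `{1, ι}`,
`ι ≠ 1` in the wild inertia group `G₁(𝔓 ∩ L)` (`card_ramificationSubgroup_one_eq_two_mul_quotient`
transported).  [cite: SerreLocalFields1979, Ch. IV §3 Lemma 5 (p. 75) and §1 Prop. 2] -/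
theorem card_ramificationSubgroup_one_eq_two_mul_layer (hle : E ≤ L) {ι : L ≃ₐ[K] L} (hι : ι ≠ 1)
    (hkerE : ∀ σ : absoluteGaloisGroup K, absRestrictNormalHom E σ = 1 ↔
      absRestrictNormalHom L σ = 1 ∨ absRestrictNormalHom L σ = ι)
    (h1 : ι ∈ (𝔓.comap (L.integralClosureToAbsIntegers (𝓞 K))).ramificationSubgroup
      (L ≃ₐ[K] L) 1) :
    Nat.card ((𝔓.comap (L.integralClosureToAbsIntegers (𝓞 K))).ramificationSubgroup
        (L ≃ₐ[K] L) 1) =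
      2 * Nat.card ((𝔓.comap (E.integralClosureToAbsIntegers (𝓞 K))).ramificationSubgroup
        (E ≃ₐ[K] E) 1) := by
  haveI : 𝔓.IsPrime := h𝔓.1
  haveI : 𝔓.IsMaximal := HeightOneSpectrum.isMaximal_of_mem_primesAbove h𝔓
  haveI : IsGalois K L := {}
  haveI : Normal K (IntermediateField.restrict hle) :=
    Normal.of_algEquiv (IntermediateField.restrict_algEquiv hle)
  set 𝔓L := 𝔓.comap (L.integralClosureToAbsIntegers (𝓞 K)) with h𝔓L
  haveI hmaxL : 𝔓L.IsMaximal := isMaximal_comap_integralClosureToAbsIntegers (𝓞 K) 𝔓 L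
  haveI : Finite ((𝓞 K) ⧸ 𝔓.under (𝓞 K)) := by
    rw [← h𝔓.2.over]
    exact Ideal.finiteQuotientOfFreeOfNeBot v.asIdeal v.ne_bot
  haveI hsepL : Algebra.IsSeparable ((𝓞 K) ⧸ 𝔓L.under (𝓞 K)) (integralClosure (𝓞 K) L ⧸ 𝔓L) :=
    isSeparable_residue_comap (𝓞 K) 𝔓 L
  have hker := restrictNormalHom_restrict_eq_one_iff L E hle hkerE
  rw [card_ramificationSubgroup_layer_eq L E hle 1]
  exact @card_ramificationSubgroup_one_eq_two_mul_quotient (𝓞 K) K L _ _ _ _ _ _ _ _ _ _ _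
    (IntermediateField.restrict hle) _ 𝔓L hmaxL hsepL ι hι hker h1

/-- **`σ|_L ∈ G₁(𝔓 ∩ L) ↔ σ|_E ∈ Q₁(𝔓 ∩ E)`** for layers `E ≤ L` of `K̄` with kernel `{1, ι}`,
`ι ∈ G₁(𝔓 ∩ L)`: `π(G₁) = Q₁` (`map_ramificationSubgroup_one_eq_of_mem`) and `G₁ ⊇ ker π`,
transported along `E ≃ restrict hle`.  [cite: SerreLocalFields1979, Ch. IV §3 Lemma 5 (p. 75)] -/
theorem absRestrictNormalHom_mem_ramificationSubgroup_one_iff_layer (hle : E ≤ L) {ι : L ≃ₐ[K] L}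
    (hkerE : ∀ σ : absoluteGaloisGroup K, absRestrictNormalHom E σ = 1 ↔
      absRestrictNormalHom L σ = 1 ∨ absRestrictNormalHom L σ = ι)
    (h1 : ι ∈ (𝔓.comap (L.integralClosureToAbsIntegers (𝓞 K))).ramificationSubgroup
      (L ≃ₐ[K] L) 1) (σ : absoluteGaloisGroup K) :
    absRestrictNormalHom L σ ∈
        (𝔓.comap (L.integralClosureToAbsIntegers (𝓞 K))).ramificationSubgroup (L ≃ₐ[K] L) 1 ↔
      absRestrictNormalHom E σ ∈
        (𝔓.comap (E.integralClosureToAbsIntegers (𝓞 K))).ramificationSubgroup (E ≃ₐ[K] E) 1 := by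
  haveI : 𝔓.IsPrime := h𝔓.1
  haveI : 𝔓.IsMaximal := HeightOneSpectrum.isMaximal_of_mem_primesAbove h𝔓
  haveI : IsGalois K L := {}
  haveI : Normal K (IntermediateField.restrict hle) :=
    Normal.of_algEquiv (IntermediateField.restrict_algEquiv hle)
  set 𝔓L := 𝔓.comap (L.integralClosureToAbsIntegers (𝓞 K)) with h𝔓L
  haveI hmaxL : 𝔓L.IsMaximal := isMaximal_comap_integralClosureToAbsIntegers (𝓞 K) 𝔓 L
  haveI : Finite ((𝓞 K) ⧸ 𝔓.under (𝓞 K)) := by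
    rw [← h𝔓.2.over]
    exact Ideal.finiteQuotientOfFreeOfNeBot v.asIdeal v.ne_bot
  haveI hsepL : Algebra.IsSeparable ((𝓞 K) ⧸ 𝔓L.under (𝓞 K)) (integralClosure (𝓞 K) L ⧸ 𝔓L) :=
    isSeparable_residue_comap (𝓞 K) 𝔓 L
  have hker := restrictNormalHom_restrict_eq_one_iff L E hle hkerE
  -- `π'(G₁) = Q'₁` for the copy `restrict hle`
  have hmap : (𝔓L.ramificationSubgroup (L ≃ₐ[K] L) 1).map
      (AlgEquiv.restrictNormalHom (IntermediateField.restrict hle) :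
        (L ≃ₐ[K] L) →* (IntermediateField.restrict hle ≃ₐ[K] IntermediateField.restrict hle)) =
      (𝔓L.comap ((IntermediateField.restrict hle).integralClosureInclusion (𝓞 K))).ramificationSubgroup
        (IntermediateField.restrict hle ≃ₐ[K] IntermediateField.restrict hle) 1 :=
    @map_ramificationSubgroup_one_eq_of_mem (𝓞 K) K L _ _ _ _ _ _ _ _ _ _ _
      (IntermediateField.restrict hle) _ 𝔓L hmaxL hsepL ι hker h1
  -- transport `Q₁(𝔓 ∩ E) = f⁻¹ Q'₁`
  have htrans : (𝔓.comap (E.integralClosureToAbsIntegers (𝓞 K))).ramificationSubgroup (E ≃ₐ[K] E) 1 =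
      ((𝔓L.comap ((IntermediateField.restrict hle).integralClosureInclusion (𝓞 K))).ramificationSubgroup
        (IntermediateField.restrict hle ≃ₐ[K] IntermediateField.restrict hle) 1).comap
        ((IntermediateField.restrict_algEquiv hle).autCongr).toMonoidHom := by
    rw [← comap_restrict_mapIntegralClosure (𝓞 K) hle 𝔓]
    exact ramificationSubgroup_comap_ringEquiv
      (((IntermediateField.restrict_algEquiv hle).restrictScalars (𝓞 K)).mapIntegralClosure.toRingEquiv)
      ((IntermediateField.restrict_algEquiv hle).autCongr).toMonoidHom
      (restrict_mapIntegralClosure_smul (𝓞 K) hle) _ 1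
  rw [htrans, Subgroup.mem_comap, MulEquiv.coe_toMonoidHom,
    ← restrictNormalHom_restrict_absRestrictNormalHom hle σ, ← hmap, Subgroup.mem_map]
  constructor
  · intro h
    exact ⟨absRestrictNormalHom L σ, h, rfl⟩
  · rintro ⟨g, hg, hgσ⟩
    -- `g` and `σ|_L` have the same image, so they differ by `1` or `ι`
    have hquot : AlgEquiv.restrictNormalHom (IntermediateField.restrict hle)
        (g⁻¹ * absRestrictNormalHom L σ) = 1 := by
      rw [map_mul, map_inv, hgσ, inv_mul_cancel]
    rcases (hker _).mp hquot with h' | h'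
    · have : absRestrictNormalHom L σ = g := by
        rw [← mul_one g, ← h', mul_inv_cancel_left]
      rw [this]; exact hg
    · have : absRestrictNormalHom L σ = g * ι := by
        rw [← h', mul_inv_cancel_left]
      rw [this]; exact Subgroup.mul_mem _ hg h1

end Layer

end Literature.NumberTheory.GaloisRepresentations

end
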